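import Mathlib
import Summits.Ventures.PercRepro2.Defs
import Summits.Ventures.PercRepro2.Harris
import Summits.Ventures.PercRepro2.Graph
import Summits.Ventures.PercRepro2.Events

/-!
# The class-(iv) graph: its root cluster in Boolean reachability formulas (mine-a g50)

The class-(iv) graph `G₄` of MINE-A.md §103.1 ADDENDUM 3 / §104.3 has vertices `r = 0`, `h = 1`,
`x₂, …, x₆` and the ten edges `r–x₂, r–x₃, r–x₄, r–x₅, r–x₆, h–x₂, h–x₃, h–x₄, x₂–x₅, x₅–x₆`
(edges `0, …, 9`): the root joined to the five middle vertices, above them the `h`-rooted tree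
`h–{x₂–x₅–x₆, x₃, x₄}`.  The cluster of the root is the explicit Boolean set `inC`
(`cluster_eq`), so the three events of the pair `(𝓤, 𝓥) = ({x₃, x₄ ∈ T}, {x₆ ∈ T})` —
`Q = {h ∈ C_r}`, `U = {x₃, x₄ ∈ C_r}`, `e = {x₆ ∈ C_r}` — are decided by `inC`.  At this pair the
main antipodal base case is `−1` (`THClassIV`).  No instance, no notation.
-/

namespace Summit.Ventures.PercRepro2

namespace THClassIV

open Finset

/-- The edge map of `G₄`: `r–x₂, r–x₃, r–x₄, r–x₅, r–x₆, h–x₂, h–x₃, h–x₄, x₂–x₅, x₅–x₆`. -/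
def ends : Fin 10 → Sym2 (Fin 7) :=
  ![s(0, 2), s(0, 3), s(0, 4), s(0, 5), s(0, 6), s(1, 2), s(1, 3), s(1, 4), s(2, 5), s(5, 6)]

section Reach

/-- Reachability of `x₂` from the root avoiding `h` (`l2`, or `a` and `x₅` from `r`/`x₆`). -/
def r2 (l2 l5 l6 a b : Bool) : Bool := l2 || (a && (l5 || (l6 && b)))

/-- Reachability of `x₅` from the root avoiding `h`. -/
def r5 (l2 l5 l6 a b : Bool) : Bool := l5 || (a && l2) || (b && l6)

/-- Reachability of `x₆` from the root avoiding `h`. -/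
def r6 (l2 l5 l6 a b : Bool) : Bool := l6 || (b && (l5 || (a && l2)))

/-- Reachability of the hit vertex. -/
def hc (l2 l3 l4 l5 l6 h2 h3 h4 a b : Bool) : Bool :=
  (r2 l2 l5 l6 a b && h2) || (l3 && h3) || (l4 && h4)

/-- The Boolean membership of every vertex in the cluster of the root, as a function of the ten
edge states `l2 l3 l4 l5 l6 h2 h3 h4 a b`. -/
def inCf (l2 l3 l4 l5 l6 h2 h3 h4 a b : Bool) : Fin 7 → Bool :=
  ![true, hc l2 l3 l4 l5 l6 h2 h3 h4 a b,
    r2 l2 l5 l6 a b || (hc l2 l3 l4 l5 l6 h2 h3 h4 a b && h2),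
    l3 || (hc l2 l3 l4 l5 l6 h2 h3 h4 a b && h3),
    l4 || (hc l2 l3 l4 l5 l6 h2 h3 h4 a b && h4),
    r5 l2 l5 l6 a b || (hc l2 l3 l4 l5 l6 h2 h3 h4 a b && h2 && a),
    r6 l2 l5 l6 a b || (hc l2 l3 l4 l5 l6 h2 h3 h4 a b && h2 && a && b)]

/-- Membership in the cluster of the root at a configuration. -/
def inC (ω : Config (Fin 10)) (v : Fin 7) : Bool :=
  inCf (ω 0) (ω 1) (ω 2) (ω 3) (ω 4) (ω 5) (ω 6) (ω 7) (ω 8) (ω 9) v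

/-- The explicit cluster set. -/
def clusterSet (ω : Config (Fin 10)) : Set (Fin 7) := {v | inC ω v = true}

/-- **Closure of the explicit set along every edge, in both directions** (a Boolean tautology in
the ten edge variables, checked by `decide`). -/
lemma closed_tauto : ∀ l2 l3 l4 l5 l6 h2 h3 h4 a b : Bool,
    let f := inCf l2 l3 l4 l5 l6 h2 h3 h4 a b
    (l2 = true → f 2 = true) ∧ (l3 = true → f 3 = true) ∧ (l4 = true → f 4 = true) ∧
    (l5 = true → f 5 = true) ∧ (l6 = true → f 6 = true) ∧
    (h2 = true → f 1 = true → f 2 = true) ∧ (h2 = true → f 2 = true → f 1 = true) ∧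
    (h3 = true → f 1 = true → f 3 = true) ∧ (h3 = true → f 3 = true → f 1 = true) ∧
    (h4 = true → f 1 = true → f 4 = true) ∧ (h4 = true → f 4 = true → f 1 = true) ∧
    (a = true → f 2 = true → f 5 = true) ∧ (a = true → f 5 = true → f 2 = true) ∧
    (b = true → f 5 = true → f 6 = true) ∧ (b = true → f 6 = true → f 5 = true) := by
  decide

/-- The explicit set is closed under open adjacency. -/
lemma clusterSet_closed (ω : Config (Fin 10)) :
    ∀ x ∈ clusterSet ω, ∀ y, (openGraph ends ω).Adj x y → y ∈ clusterSet ω := by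
  intro x hx y hxy
  obtain ⟨-, e, he, hends⟩ := openGraph_adj.1 hxy
  have ht := closed_tauto (ω 0) (ω 1) (ω 2) (ω 3) (ω 4) (ω 5) (ω 6) (ω 7) (ω 8) (ω 9)
  simp only [clusterSet, Set.mem_setOf_eq, inC] at hx ⊢
  fin_cases e <;> simp only [ends, Fin.isValue] at hends he <;>
    rcases Sym2.eq_iff.1 hends with ⟨rfl, rfl⟩ | ⟨rfl, rfl⟩
  all_goals first
    | exact (ht.1 he) | exact (ht.2.1 he) | exact (ht.2.2.1 he) | exact (ht.2.2.2.1 he)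
    | exact (ht.2.2.2.2.1 he) | exact (ht.2.2.2.2.2.1 he hx) | exact (ht.2.2.2.2.2.2.1 he hx)
    | exact (ht.2.2.2.2.2.2.2.1 he hx) | exact (ht.2.2.2.2.2.2.2.2.1 he hx)
    | exact (ht.2.2.2.2.2.2.2.2.2.1 he hx) | exact (ht.2.2.2.2.2.2.2.2.2.2.1 he hx)
    | exact (ht.2.2.2.2.2.2.2.2.2.2.2.1 he hx) | exact (ht.2.2.2.2.2.2.2.2.2.2.2.2.1 he hx)
    | exact (ht.2.2.2.2.2.2.2.2.2.2.2.2.2.1 he hx) | exact (ht.2.2.2.2.2.2.2.2.2.2.2.2.2.2 he hx)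
    | rfl

/-- Connections along single open edges (the ten edges, both ends). -/
lemma conn_edge (ω : Config (Fin 10)) (i : Fin 10) (u v : Fin 7) (h : ω i = true)
    (hi : ends i = s(u, v)) : Conn ends ω u v := conn_of_openAdj ⟨i, h, hi⟩

/-- `r2` gives a connection `r ↔ x₂` (without `h`). -/
lemma conn_of_r2 (ω : Config (Fin 10)) (h : r2 (ω 0) (ω 3) (ω 4) (ω 8) (ω 9) = true) :
    Conn ends ω 0 2 := by
  unfold r2 at h
  simp only [Bool.or_eq_true, Bool.and_eq_true] at h
  rcases h with h0 | ⟨h8, h3 | ⟨h4, h9⟩⟩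
  · exact conn_edge ω 0 0 2 h0 rfl
  · exact conn_trans (conn_edge ω 3 0 5 h3 rfl) (conn_symm (conn_edge ω 8 2 5 h8 rfl))
  · exact conn_trans (conn_trans (conn_edge ω 4 0 6 h4 rfl) (conn_symm (conn_edge ω 9 5 6 h9 rfl)))
      (conn_symm (conn_edge ω 8 2 5 h8 rfl))

/-- `r5` gives a connection `r ↔ x₅`. -/
lemma conn_of_r5 (ω : Config (Fin 10)) (h : r5 (ω 0) (ω 3) (ω 4) (ω 8) (ω 9) = true) :
    Conn ends ω 0 5 := by
  unfold r5 at h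
  simp only [Bool.or_eq_true, Bool.and_eq_true] at h
  rcases h with (h3 | ⟨h8, h0⟩) | ⟨h9, h4⟩
  · exact conn_edge ω 3 0 5 h3 rfl
  · exact conn_trans (conn_edge ω 0 0 2 h0 rfl) (conn_edge ω 8 2 5 h8 rfl)
  · exact conn_trans (conn_edge ω 4 0 6 h4 rfl) (conn_symm (conn_edge ω 9 5 6 h9 rfl))

/-- `r6` gives a connection `r ↔ x₆`. -/
lemma conn_of_r6 (ω : Config (Fin 10)) (h : r6 (ω 0) (ω 3) (ω 4) (ω 8) (ω 9) = true) :
    Conn ends ω 0 6 := by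
  unfold r6 at h
  simp only [Bool.or_eq_true, Bool.and_eq_true] at h
  rcases h with h4 | ⟨h9, h3 | ⟨h8, h0⟩⟩
  · exact conn_edge ω 4 0 6 h4 rfl
  · exact conn_trans (conn_edge ω 3 0 5 h3 rfl) (conn_edge ω 9 5 6 h9 rfl)
  · exact conn_trans (conn_trans (conn_edge ω 0 0 2 h0 rfl) (conn_edge ω 8 2 5 h8 rfl))
      (conn_edge ω 9 5 6 h9 rfl)

/-- `hc` gives a connection `r ↔ h`. -/
lemma conn_of_hc (ω : Config (Fin 10))
    (h : hc (ω 0) (ω 1) (ω 2) (ω 3) (ω 4) (ω 5) (ω 6) (ω 7) (ω 8) (ω 9) = true) :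
    Conn ends ω 0 1 := by
  unfold hc at h
  simp only [Bool.or_eq_true, Bool.and_eq_true] at h
  rcases h with (⟨hr, h5⟩ | ⟨h1, h6⟩) | ⟨h2, h7⟩
  · exact conn_trans (conn_of_r2 ω hr) (conn_symm (conn_edge ω 5 1 2 h5 rfl))
  · exact conn_trans (conn_edge ω 1 0 3 h1 rfl) (conn_symm (conn_edge ω 6 1 3 h6 rfl))
  · exact conn_trans (conn_edge ω 2 0 4 h2 rfl) (conn_symm (conn_edge ω 7 1 4 h7 rfl))

/-- Every vertex of the explicit set is connected to the root. -/
lemma conn_of_inC (ω : Config (Fin 10)) (v : Fin 7) (h : inC ω v = true) : Conn ends ω 0 v := by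
  fin_cases v
  · exact conn_refl ends ω 0
  · exact conn_of_hc ω h
  · change (r2 (ω 0) (ω 3) (ω 4) (ω 8) (ω 9)
      || (hc (ω 0) (ω 1) (ω 2) (ω 3) (ω 4) (ω 5) (ω 6) (ω 7) (ω 8) (ω 9) && ω 5)) = true at h
    simp only [Bool.or_eq_true, Bool.and_eq_true] at h
    rcases h with hr | ⟨hh, h5⟩
    · exact conn_of_r2 ω hr
    · exact conn_trans (conn_of_hc ω hh) (conn_edge ω 5 1 2 h5 rfl)
  · change (ω 1 || (hc (ω 0) (ω 1) (ω 2) (ω 3) (ω 4) (ω 5) (ω 6) (ω 7) (ω 8) (ω 9) && ω 6)) = true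
      at h
    simp only [Bool.or_eq_true, Bool.and_eq_true] at h
    rcases h with h1 | ⟨hh, h6⟩
    · exact conn_edge ω 1 0 3 h1 rfl
    · exact conn_trans (conn_of_hc ω hh) (conn_edge ω 6 1 3 h6 rfl)
  · change (ω 2 || (hc (ω 0) (ω 1) (ω 2) (ω 3) (ω 4) (ω 5) (ω 6) (ω 7) (ω 8) (ω 9) && ω 7)) = true
      at h
    simp only [Bool.or_eq_true, Bool.and_eq_true] at h
    rcases h with h2 | ⟨hh, h7⟩
    · exact conn_edge ω 2 0 4 h2 rfl
    · exact conn_trans (conn_of_hc ω hh) (conn_edge ω 7 1 4 h7 rfl)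
  · change (r5 (ω 0) (ω 3) (ω 4) (ω 8) (ω 9)
      || (hc (ω 0) (ω 1) (ω 2) (ω 3) (ω 4) (ω 5) (ω 6) (ω 7) (ω 8) (ω 9) && ω 5 && ω 8)) = true at h
    simp only [Bool.or_eq_true, Bool.and_eq_true] at h
    rcases h with hr | ⟨⟨hh, h5⟩, h8⟩
    · exact conn_of_r5 ω hr
    · exact conn_trans (conn_trans (conn_of_hc ω hh) (conn_edge ω 5 1 2 h5 rfl))
        (conn_edge ω 8 2 5 h8 rfl)
  · change (r6 (ω 0) (ω 3) (ω 4) (ω 8) (ω 9)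
      || (hc (ω 0) (ω 1) (ω 2) (ω 3) (ω 4) (ω 5) (ω 6) (ω 7) (ω 8) (ω 9) && ω 5 && ω 8 && ω 9)) = true
      at h
    simp only [Bool.or_eq_true, Bool.and_eq_true] at h
    rcases h with hr | ⟨⟨⟨hh, h5⟩, h8⟩, h9⟩
    · exact conn_of_r6 ω hr
    · exact conn_trans (conn_trans (conn_trans (conn_of_hc ω hh) (conn_edge ω 5 1 2 h5 rfl))
        (conn_edge ω 8 2 5 h8 rfl)) (conn_edge ω 9 5 6 h9 rfl)

/-- **The cluster of the root of `G₄`** is the explicit set. -/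
theorem cluster_eq (ω : Config (Fin 10)) : cluster ends ω 0 = clusterSet ω := by
  apply Set.Subset.antisymm
  · intro v hv
    exact mem_of_conn_of_closed (clusterSet_closed ω) (by simp [clusterSet, inC, inCf]) hv
  · intro v hv
    exact conn_of_inC ω v hv

/-- Membership of a vertex in the cluster, decided by `inC`. -/
lemma mem_cluster_iff (ω : Config (Fin 10)) (v : Fin 7) :
    v ∈ cluster ends ω 0 ↔ inC ω v = true := by
  rw [cluster_eq]; rfl

end Reach

section Events

/-- The up-set `𝓤 = {x₃, x₄ ∈ T}` (`= ↑{r, x₃, x₄}` on clusters of the root). -/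
def 𝓤 : Set (Set (Fin 7)) := {T | (3 : Fin 7) ∈ T ∧ (4 : Fin 7) ∈ T}

/-- The up-set `𝓥 = {x₆ ∈ T}` (`= ↑{r, x₆}`). -/
def 𝓥 : Set (Set (Fin 7)) := {T | (6 : Fin 7) ∈ T}

/-- `𝓤` is an up-set. -/
lemma isUpperSet_𝓤 : IsUpperSet 𝓤 := fun _ _ h hT => ⟨h hT.1, h hT.2⟩

/-- `𝓥` is an up-set. -/
lemma isUpperSet_𝓥 : IsUpperSet 𝓥 := fun _ _ h hT => h hT

/-- The hit event `Q = {h ∈ C_r}`. -/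
def Q : Set (Config (Fin 10)) := clusterInEvent ends 0 {T : Set (Fin 7) | (1 : Fin 7) ∈ T}

/-- The event `U = {C_r ∈ 𝓤} = {x₃, x₄ ∈ C_r}`. -/
def U : Set (Config (Fin 10)) := clusterInEvent ends 0 𝓤

/-- The event `e = {C_r ∈ 𝓥} = {x₆ ∈ C_r}`. -/
def e : Set (Config (Fin 10)) := clusterInEvent ends 0 𝓥

/-- `Q` is decided by `inC · 1`. -/
def qB (ω : Config (Fin 10)) : Bool := inC ω 1

/-- `U` is decided by `inC · 3 && inC · 4`. -/
def uB (ω : Config (Fin 10)) : Bool := inC ω 3 && inC ω 4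

/-- `e` is decided by `inC · 6`. -/
def eB (ω : Config (Fin 10)) : Bool := inC ω 6

/-- The hit event is decided by `qB`. -/
lemma mem_Q_iff (ω : Config (Fin 10)) : ω ∈ Q ↔ qB ω = true := by
  rw [Q, mem_clusterInEvent, Set.mem_setOf_eq, mem_cluster_iff]; rfl

/-- `U` is decided by `uB`. -/
lemma mem_U_iff (ω : Config (Fin 10)) : ω ∈ U ↔ uB ω = true := by
  rw [U, mem_clusterInEvent, 𝓤, Set.mem_setOf_eq, mem_cluster_iff, mem_cluster_iff, uB,
    Bool.and_eq_true]

/-- `e` is decided by `eB`. -/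
lemma mem_e_iff (ω : Config (Fin 10)) : ω ∈ e ↔ eB ω = true := by
  rw [e, mem_clusterInEvent, 𝓥, Set.mem_setOf_eq, mem_cluster_iff]; rfl

end Events

end THClassIV

end Summit.Ventures.PercRepro2
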